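import Summits.FinalStateConjecture.FinalStateConjecture.Theorems.PhotonSphereChannelsTameCensorshipExactRegionCausality
import HarnessLib

/-!
# Crux `TameCensorship` (stmt-FinalStateConjecture-10047), line `crush-the-swallowed-interior`:
# the causal core of stub B (`stub_exactKerrBookkeeping`) — the exact region lies in the domain
# of dependence of the unperturbed piece `ι(range φ)`

Continuation of `…TameCensorshipExactRegionCausality` (def-free causal lemmas for the registered
stub `stub_exactKerrBookkeeping`; `𝒟` a Cauchy development of a datum on `X`, `φ : N → X` an
open embedding, `K = (range φ)ᶜ`, `E = J⁺(ιX) ∖ J⁺(ιK)` the exact region):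

* `exactRegion_subset_dodComponent` — for connected nonempty `N` and compact `K`, `E` lies in the
  connected component `V` of `𝒟 ∖ closure (I⁺(ιK) ∪ I⁻(ιK) ∪ ιK)` containing `ι(range φ)`
  (`E` misses that closure, `exactRegion_disjoint_closure`, and each of its points is joined to
  the connected set `ι(range φ) ⊆ E` by a causal curve inside `E`, `curve_mem_exactRegion`);
* `isCauchyHypersurface_dodComponent` — `V` is an open connected sub-spacetime of `𝒟` in which
  `ι(range φ)` is a CAUCHY hypersurface (`IsCauchyHypersurface.restrict_of_disjoint_closure`,
  the construction of `CauchyDevelopment.exists_isConnected_restrict_image` with the component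
  made explicit): the domain of dependence of the unperturbed piece of the datum, i.e. the
  carrier of the sub-data development `𝒟.comapAlongRestrict φ V` through which a maximal
  development of the sub-data receives `E` (file `…TameCensorshipExactRegionOfLeafMaximal`).

References: O'Neill 1983, Ch. 14, Lemma 14.43, Thm. 14.38; Hawking–Ellis 1973, §6.5–6.6,
Prop. 6.6.3; Choquet-Bruhat–Geroch 1969, p. 333 (developments of part of the data).
-/

noncomputable section

-- The tree namespace `Summit.FinalStateConjecture.FinalStateConjecture.…` (summit = sub-problem)
-- repeats a component by design (D-0022), which the `dupNamespace` linter would flag on every decl.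
set_option linter.dupNamespace false

open scoped Manifold ContDiff Topology
open Set Filter Function TopologicalSpace Topology
open Literature.Geometry.Lorentzian

namespace Summit.FinalStateConjecture.FinalStateConjecture.Theorems.PhotonSphereChannels.TameCensorshipCrush

universe u

variable {n : ℕ} {X : Type u} [TopologicalSpace X] [ChartedSpace (EuclideanSpace ℝ (Fin n)) X]
  [IsManifold (𝓡 n) ∞ X] [ConnectedSpace X] {D : InitialDataSet (𝓡 n) X}


/-! ## The exact region lies in the domain of dependence of `ι(range φ)` -/

/-- **The exact region lies in one component of the complement.** For an open embedding
`φ : N → X` of a connected nonempty `N` with co-compact range, every point `p` of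
`E = J⁺(ιX) ∖ J⁺(ι (range φ)ᶜ)` lies in the connected component of
`𝒟 ∖ closure (I⁺(ιK) ∪ I⁻(ιK) ∪ ιK)` (`K = (range φ)ᶜ`) containing `ι(φ u₀)`: `p` is joined to a
point `s ∈ ιX ∖ ιK = ι(range φ)` by a causal curve, which lies in `E` (`curve_mem_exactRegion`),
hence in that complement (`exactRegion_disjoint_closure`), and `ι(range φ)` is connected.
[cite: ONeillSemiRiemannian1983, Ch. 14, Lemma 14.43 and Thm. 14.38 (pp. 425–426)] -/
theorem exactRegion_subset_dodComponent (𝒟 : CauchyDevelopment D) {N : Type*}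
    [TopologicalSpace N] [ConnectedSpace N] {φ : N → X} (hφ : IsOpenEmbedding φ)
    (hK : IsCompact (range φ)ᶜ) (u₀ : N) :
    𝒟.metric.causalFuture 𝒟.timeOrientation (range 𝒟.embed) \
        𝒟.metric.causalFuture 𝒟.timeOrientation (𝒟.embed '' (range φ)ᶜ) ⊆
      connectedComponentIn
        (closure (𝒟.metric.chronologicalFuture 𝒟.timeOrientation
            (range 𝒟.embed \ 𝒟.embed '' range φ) ∪
          𝒟.metric.chronologicalPast 𝒟.timeOrientation (range 𝒟.embed \ 𝒟.embed '' range φ) ∪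
          (range 𝒟.embed \ 𝒟.embed '' range φ)))ᶜ
        (𝒟.embed (φ u₀)) := by
  set g := 𝒟.metric with hg
  set τ := 𝒟.timeOrientation with hτ_def
  set F : Set 𝒟.carrier := g.chronologicalFuture τ (range 𝒟.embed \ 𝒟.embed '' range φ) ∪
    g.chronologicalPast τ (range 𝒟.embed \ 𝒟.embed '' range φ) ∪
    (range 𝒟.embed \ 𝒟.embed '' range φ) with hF_def
  set E : Set 𝒟.carrier := g.causalFuture τ (range 𝒟.embed) \
    g.causalFuture τ (𝒟.embed '' (range φ)ᶜ) with hE_def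
  have hEF : Disjoint E (closure F) := exactRegion_disjoint_closure 𝒟 hφ.isOpen_range hK
  have hEV₀ : E ⊆ (closure F)ᶜ := Set.disjoint_left.1 hEF
  -- `ι(range φ) ⊆ E`
  have hιE : 𝒟.embed '' range φ ⊆ E := by
    rintro _ ⟨y, ⟨u, rfl⟩, rfl⟩
    refine ⟨LorentzianMetric.subset_causalFuture g τ _ ⟨φ u, rfl⟩, fun h ↦ ?_⟩
    -- `ι(φ u) ∈ J⁺(ιK)` with `ιK ⊆ ιX`: then `ι(φ u) ∈ J⁻`… use acausality via the time dual:
    -- `ι(φ u) ∈ J⁺(ιK)` means some `k ∈ ιK` with `ι(φ u) ∈ J⁺(k)`; both on `ιX`, so `k = ι(φ u)`.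
    rw [LorentzianMetric.causalFuture_eq_biUnion] at h
    simp only [mem_iUnion, exists_prop] at h
    obtain ⟨k, ⟨y, hy, rfl⟩, hk⟩ := h
    rcases hk with hk | ⟨k', hk', γ, c, d, hcd, hγ, hγc, hγd⟩
    · rw [mem_singleton_iff] at hk
      exact hy ⟨u, 𝒟.isSmoothEmbedding.isEmbedding.injective hk⟩
    · rw [mem_singleton_iff] at hk'
      subst hk'
      exact 𝒟.false_of_isFutureCausalCurveOn_range_embed hcd hγ (hγc ▸ ⟨y, rfl⟩) (hγd ▸ ⟨φ u, rfl⟩)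
  -- `ι(range φ)` is preconnected and contains `ι(φ u₀)`
  have hιc : IsPreconnected (𝒟.embed '' range φ) :=
    ((isConnected_range hφ.continuous).image 𝒟.embed
      𝒟.isSmoothEmbedding.contMDiff.continuous.continuousOn).isPreconnected
  have hι₀ : 𝒟.embed (φ u₀) ∈ 𝒟.embed '' range φ := ⟨φ u₀, ⟨u₀, rfl⟩, rfl⟩
  have hιV : 𝒟.embed '' range φ ⊆ connectedComponentIn (closure F)ᶜ (𝒟.embed (φ u₀)) :=
    hιc.subset_connectedComponentIn hι₀ (hιE.trans hEV₀)
  -- a point of `E` is joined to `ι(range φ)` by a causal curve inside `E`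
  intro p hp
  have hpS := hp.1
  rw [LorentzianMetric.causalFuture_eq_biUnion] at hpS
  simp only [mem_iUnion, exists_prop] at hpS
  obtain ⟨s, hsS, hps⟩ := hpS
  have hsE : s ∈ E := by
    refine ⟨LorentzianMetric.subset_causalFuture g τ _ hsS, fun hsK ↦ hp.2 ?_⟩
    exact causalFuture_singleton_subset_of_mem 𝒟 _ hsK hps
  have hsι : s ∈ 𝒟.embed '' range φ := by
    obtain ⟨y, rfl⟩ := hsS
    refine ⟨y, by_contra fun hy ↦ hsE.2 ?_, rfl⟩
    exact LorentzianMetric.subset_causalFuture g τ _ ⟨y, hy, rfl⟩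
  have hsV : s ∈ connectedComponentIn (closure F)ᶜ (𝒟.embed (φ u₀)) := hιV hsι
  rcases hps with hps | ⟨s', hs', γ, a, b, hab, hγ, hγa, hγb⟩
  · rw [mem_singleton_iff] at hps
    rw [hps]
    exact hsV
  · rw [mem_singleton_iff] at hs'
    subst hs'
    -- the curve lies in `E ⊆ (closure F)ᶜ`, and is connected
    have hcurve : γ '' Icc a b ⊆ E := by
      rintro _ ⟨t, ht, rfl⟩
      exact curve_mem_exactRegion 𝒟 _ _ hγ (hγa ▸ hsE) (hγb ▸ hp) ht
    have hcont : ContinuousOn γ (Icc a b) := fun t ht ↦ (hγ.continuousAt ht).continuousWithinAt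
    have hpre : IsPreconnected (γ '' Icc a b) := isPreconnected_Icc.image γ hcont
    have haim : γ a ∈ γ '' Icc a b := ⟨a, left_mem_Icc.2 hab.le, rfl⟩
    have hbim : γ b ∈ γ '' Icc a b := ⟨b, right_mem_Icc.2 hab.le, rfl⟩
    have hsub : γ '' Icc a b ⊆ connectedComponentIn (closure F)ᶜ (γ a) :=
      hpre.subset_connectedComponentIn haim (hcurve.trans hEV₀)
    have heq : connectedComponentIn (closure F)ᶜ (𝒟.embed (φ u₀)) =
        connectedComponentIn (closure F)ᶜ (γ a) :=
      connectedComponentIn_eq (hγa ▸ hsV)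
    rw [heq, ← hγb]
    exact hsub hbim

/-- **`ι(range φ)` is a Cauchy hypersurface of that component** — the open connected
sub-spacetime `V` (restricted metric and time orientation) given by the connected component of
`𝒟 ∖ closure (I⁺(ιK) ∪ I⁻(ιK) ∪ ιK)` containing `ι(φ u₀)`: the domain of dependence of the piece
`ι(range φ)` of the Cauchy hypersurface `ιX` (Hawking–Ellis 1973, Prop. 6.6.3; O'Neill 1983,
Lemma 14.43 / Thm. 14.38), by `IsCauchyHypersurface.restrict_of_disjoint_closure` — the same
construction as `CauchyDevelopment.exists_isConnected_restrict_image`, with the component made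
explicit so that `exactRegion_subset_dodComponent` places the exact region inside it.
[cite: ONeillSemiRiemannian1983, Ch. 14, Lemma 14.43 and Thm. 14.38 (pp. 425–426); HawkingEllis1973CUP, §6.6, Prop. 6.6.3] -/
theorem isCauchyHypersurface_dodComponent (𝒟 : CauchyDevelopment D) {N : Type*}
    [TopologicalSpace N] [ConnectedSpace N] {φ : N → X} (hφ : IsOpenEmbedding φ) (u₀ : N) :
    ∃ hV : IsOpen (connectedComponentIn
        (closure (𝒟.metric.chronologicalFuture 𝒟.timeOrientation
            (range 𝒟.embed \ 𝒟.embed '' range φ) ∪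
          𝒟.metric.chronologicalPast 𝒟.timeOrientation (range 𝒟.embed \ 𝒟.embed '' range φ) ∪
          (range 𝒟.embed \ 𝒟.embed '' range φ)))ᶜ
        (𝒟.embed (φ u₀))),
      IsConnected (connectedComponentIn
        (closure (𝒟.metric.chronologicalFuture 𝒟.timeOrientation
            (range 𝒟.embed \ 𝒟.embed '' range φ) ∪
          𝒟.metric.chronologicalPast 𝒟.timeOrientation (range 𝒟.embed \ 𝒟.embed '' range φ) ∪
          (range 𝒟.embed \ 𝒟.embed '' range φ)))ᶜ
        (𝒟.embed (φ u₀))) ∧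
      (∀ u, 𝒟.embed (φ u) ∈ (⟨_, hV⟩ : Opens 𝒟.carrier)) ∧
      (𝒟.metric.restrict PseudoRiemannianMetric.contMDiff_restrict_holds ⟨_, hV⟩).IsCauchyHypersurface
        (𝒟.timeOrientation.restrict PseudoRiemannianMetric.contMDiff_restrict_holds
          𝒟.timeOrientation.contMDiff_restrict_holds ⟨_, hV⟩)
        (Subtype.val ⁻¹' range (𝒟.embed ∘ φ)) := by
  set g := 𝒟.metric with hg
  set τ := 𝒟.timeOrientation with hτ_def
  haveI : Fact ((1 : ℕ∞ω) ≤ ∞) := ⟨by exact_mod_cast le_top⟩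
  haveI : g.HasLeviCivita := g.toPseudoRiemannianMetric.hasLeviCivita
  haveI : CovariantDerivative.ContMDiffCovariantDerivative g.leviCivita 1 :=
    ⟨g.toPseudoRiemannianMetric.isLocallyContMDiff_leviCivita_holds 1
      (by rw [show ((1 : ℕ∞) : ℕ∞ω) + 1 = 2 by norm_num]; exact WithTop.coe_le_coe.2 le_top)
      univ isOpen_univ⟩
  haveI : LocallyConnectedSpace 𝒟.carrier :=
    ChartedSpace.locallyConnectedSpace (EuclideanSpace ℝ (Fin (n + 1))) 𝒟.carrier
  have hn2 : (2 : ℕ∞ω) ≤ ∞ := WithTop.coe_le_coe.mpr le_top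
  have hninf : (∞ : ℕ∞ω) ≤ ∞ := le_rfl
  have hS : g.IsCauchyHypersurface τ (range 𝒟.embed) := 𝒟.isCauchyHypersurface
  set A : Set 𝒟.carrier := 𝒟.embed '' range φ with hA_def
  set F : Set 𝒟.carrier := g.chronologicalFuture τ (range 𝒟.embed \ A) ∪
    g.chronologicalPast τ (range 𝒟.embed \ A) ∪ (range 𝒟.embed \ A) with hF_def
  have hAS : A ⊆ range 𝒟.embed := image_subset_range _ _
  have hOpen : ∀ a ∈ A, ∀ᶠ σ in 𝓝 a, σ ∈ range 𝒟.embed → σ ∈ A := by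
    rintro _ ⟨y, hy, rfl⟩
    exact 𝒟.toDataEmbedding.eventually_mem_image_of_isOpen hφ.isOpen_range hy
  have hslab : ∀ a ∈ A, ∃ ν : TangentSpace (𝓡 (n + 1)) a,
      g.IsTimelike ν ∧ τ.IsFutureDirected ν ∧ ∀ κ : ℝ, 0 < κ → ∀ᶠ σ in 𝓝 a, σ ∈ range 𝒟.embed →
        |g.val a ν (extChartAt (𝓡 (n + 1)) a σ - extChartAt (𝓡 (n + 1)) a a)| ≤
          κ * ‖extChartAt (𝓡 (n + 1)) a σ - extChartAt (𝓡 (n + 1)) a a‖ := by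
    rintro _ ⟨y, hy, rfl⟩
    refine ⟨𝒟.normal y, ?_, 𝒟.isFutureUnitNormal.2 y, fun κ hκ ↦
      𝒟.toDataEmbedding.eventually_abs_val_normal_le y hκ⟩
    show g.val _ (𝒟.normal y) (𝒟.normal y) < 0
    rw [𝒟.isFutureUnitNormal.1.2 y]
    norm_num
  have hdisj : Disjoint A (closure F) :=
    LorentzianMetric.IsCauchyHypersurface.disjoint_closure_of_spacelike hn2 hS hAS hOpen hslab
  have hE : ∀ {c : ℝ → 𝒟.carrier} {s : Set ℝ} {e : 𝒟.carrier} {t t' : ℝ}, s.OrdConnected →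
      g.IsFutureTimelikeCurveOn τ c s → HasPastEndpoint c s e → t ∈ s → t' ∈ s → t < t' →
      c t' ∈ g.chronologicalFuture τ {e} := fun hs hc he ht ht' htt' ↦
    LorentzianMetric.mem_chronologicalFuture_of_hasPastEndpoint τ hninf hs hc he ht ht' htt'
  have hE' : ∀ {c : ℝ → 𝒟.carrier} {s : Set ℝ} {e : 𝒟.carrier} {t t' : ℝ}, s.OrdConnected →
      g.IsFutureTimelikeCurveOn τ.reverse c s → HasPastEndpoint c s e → t ∈ s → t' ∈ s → t < t' →
      c t' ∈ g.chronologicalFuture τ.reverse {e} := fun hs hc he ht ht' htt' ↦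
    LorentzianMetric.mem_chronologicalFuture_of_hasPastEndpoint τ.reverse hninf hs hc he ht ht' htt'
  -- the component
  set V₀ : Set 𝒟.carrier := (closure F)ᶜ with hV₀
  have hV₀o : IsOpen V₀ := isClosed_closure.isOpen_compl
  have hAV₀ : A ⊆ V₀ := Set.disjoint_left.1 hdisj
  set a₀ : 𝒟.carrier := 𝒟.embed (φ u₀) with ha₀_def
  have ha₀ : a₀ ∈ A := ⟨φ u₀, ⟨u₀, rfl⟩, rfl⟩
  set V₁ : Set 𝒟.carrier := connectedComponentIn V₀ a₀ with hV₁
  have hV₁o : IsOpen V₁ := hV₀o.connectedComponentIn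
  have hV₁sub : V₁ ⊆ V₀ := connectedComponentIn_subset _ _
  have ha₀V₀ : a₀ ∈ V₀ := hAV₀ ha₀
  have hAc : IsPreconnected A :=
    ((isConnected_range hφ.continuous).image 𝒟.embed
      𝒟.isSmoothEmbedding.contMDiff.continuous.continuousOn).isPreconnected
  have hAV₁ : A ⊆ V₁ := hAc.subset_connectedComponentIn ha₀ hAV₀
  refine ⟨hV₁o, ⟨⟨a₀, mem_connectedComponentIn ha₀V₀⟩, isPreconnected_connectedComponentIn⟩,
    fun u ↦ hAV₁ ⟨φ u, ⟨u, rfl⟩, rfl⟩, ?_⟩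
  have hC := hS.restrict_of_disjoint_closure hn2 hE hE'
    PseudoRiemannianMetric.contMDiff_restrict_holds τ.contMDiff_restrict_holds hAS ⟨V₁, hV₁o⟩ hAV₁
    (Set.disjoint_left.2 fun x hx hxF ↦ hV₁sub hx hxF) ?_
  · rw [range_comp]
    exact hC
  · -- `V₁` is relatively closed in `V₀`
    rintro x ⟨hxcl, hxF⟩
    have hxV₀ : x ∈ V₀ := hxF
    obtain ⟨U, hUV₀, hUo, hxU, hUc⟩ :=
      (locallyConnectedSpace_iff_subsets_isOpen_isConnected.1 inferInstance) x V₀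
        (hV₀o.mem_nhds hxV₀)
    obtain ⟨y, hyU, hyV₁⟩ : (U ∩ V₁).Nonempty := mem_closure_iff_nhds.1 hxcl U (hUo.mem_nhds hxU)
    have hpre : IsPreconnected (V₁ ∪ U) :=
      isPreconnected_connectedComponentIn.union y hyV₁ hyU hUc.isPreconnected
    have hsub : V₁ ∪ U ⊆ V₁ :=
      hpre.subset_connectedComponentIn (Or.inl (mem_connectedComponentIn ha₀V₀))
        (union_subset hV₁sub hUV₀)
    exact hsub (Or.inr hxU)

end Summit.FinalStateConjecture.FinalStateConjecture.Theorems.PhotonSphereChannels.TameCensorshipCrush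

end
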